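import Literature.MathematicalPhysics.QuantumFieldTheory.Balaban1983to89.Node00.OpsYRecordV11

/-!
# def-Y's KNIT LETTERS OF RECORD WITH PRINT's HÖLDER TRANSPORTER (v11H): averaging contours KNIT (`parKnitY`, [Balaban1985Averaging] Prop. 2), Hölder
# quotients over SHORTEST contours (`parSymY`, (3.40)) — Balaban, Commun. Math. Phys. **99** (1985) 389–434, (3.19) p.393, (3.40)–(3.45) pp.397–398, (3.115) p.418

[cite: Balaban1985BackgroundPropagators, (3.19) p.393, (3.24)–(3.27) pp.394–395, (3.40)–(3.47) pp.397–398, (3.48) p.398, (3.115) p.418, (3.122)–(3.132)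
pp.420–422, Thm 3.15 p.432] [cite: Balaban1985Averaging, Prop. 2 p.26, (52)–(53) p.26, (15) p.19]

WHY THIS FILE (CASCADE-K K0, director-ym №383; dag-n06-c g23's ⚑ FLAG K1-PAR, fleet bus 2026-08-30).  In print TWO contour families occur: the AVERAGING
contours `Γ_{y,x}` of (3.19)∕(3.21) inside `Q(U) ∕ Q′(U) ∕ Δ′_a ∕ G′ ∕ R ∕ H ∕ G₁ ∕ …` — at the record these are [Balaban1985Averaging]'s KNIT contour
variables `parKnitY` (products of the averaged fields `Ū^j`, the only choice under which (3.115) holds for print's `Q`) — and the SHORTEST contours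
`Γ_{x,x′}` of (3.40) p.397 transporting the HÖLDER difference quotients (3.41)–(3.45) of every kernel.  def-Y's letter record `CovLettersY` has ONE site
transporter field `parS`; in the operator layer its ONLY reading is the Hölder transporter of the `G′` kernel family (`OpsYOfLetters`:
`Gp := kernelFamilyS … 𝔏.Gp 𝔏.parS`), every composite letter carrying its averaging contours INSIDE (`Gp = GpY parKnitY`, `GD = G̃[𝔮](parKnitY, G′_phys)`,
…).  The v11 record (`OpsYRecordV11`, `withTransportK`) set `parS := parKnitY`, i.e. it put the KNIT letter into the HÖLDER slot — but `parKnitY U z z′ = 1`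
off corner pairs, so Hölder quotients over it are the NON-covariant ones, not print's (dag-n06-c's facts (1)–(3)).  This ADDITIVE edition resets exactly
that slot and nothing else:

* §1 `CovLettersY.withParS 𝔏 parH hparH` — replace ONLY `parS ∕ parS_one`; all fifteen other letters `rfl`-unchanged (faces).
* §2 ★★★ `lettersYOfRecordV11H … 𝔮 𝔮⋆ h𝔮 h𝔮⋆ 𝔯 := fun x => (lettersYOfRecordV11 … x).withParS (parSymY x) …` over an averaging pair, and its KNIT-PAIR
  instance ★★★ `lettersYOfRecordV11KH … 𝔯` (= `(lettersYOfRecordV11K … x).withParS (parSymY x) …`, `rfl`): averaging transporter `parKnitY` in EVERY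
  composite, Hölder transporter `parSymY`; the transfer lemmas `…_letters` (thirteen letters = the v11 ∕ v11K record's, `rfl`) so that every row of
  `OpsYRecordV11 ∕ OpsYRecordV11Reg335 ∕ OpsYRecordV11Thresh` stated on `(lettersYOfRecordV11K … x).GD ∕ .G₁ ∕ .GG ∕ .H ∕ …` applies verbatim after one `rw`.
* §3 the star instances ★★★ `opsYStOfRecordV11HE ∕ opsYNuStOfRecordV11HE` (pair-generic) and ★★★ `opsYStOfRecordV11KHE ∕ opsYNuStOfRecordV11KHE` (knit pair)
  `:= opsYSectESt … (opsYS349[Nu]OfLetters … 𝔏 𝔈) 𝔏 𝔢 𝔴` at these letters — the candidate OBJECT OF RECORD for the re-keyed N06 certificate (K3).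
* §4 ★★★ THE THREE LEAF PINS of dag-n06-d's `b9LeafX_carriersYU[Par]` at the knit instances, in the split shape `(parA, parH) = (parKnitY, parSymY)`:
  `kernelFamilyR R₁ R₂ (ops x).Gp = kernelFamilyS x (bg9YR … R₁ R₂ x) id (GpY x (parKnitY x)) (parSymY x)`, the `GA` pin at `G[𝔮](parKnitY, G′_latt)`
  (and at `G′_phys`), and the `Cinv` pin `siteKernelR R₁ R₂ (ops x).Cinv = ⟨block kernel of C(U; parKnitY, G′(parKnitY))⟩` (= `CinvY P f G (fun j =>
  parKnitY (f j)) j` at `R := regC335 ∕ regC336`, by unfolding) — all `rfl`.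

HONEST STATUS.  Typing and bookkeeping (structure updates and `rfl` faces) over landed definitions; no estimate of [B9] is asserted; nothing about N06 is
discharged here.  0 `sorry`.
-/

namespace Literature.MathematicalPhysics.QuantumFieldTheory.Balaban1983to89.Node00

open B6Ineq2142KLevelV1 (β)
open B6KLevelCensusIndexV1 (KIdx)
open B9PinMembersKLevelV1 (MemberY geo9Y bg9Y)
open B9BackgroundsKLevelV1R (RegFamY bg9YR kernelFamilyR siteKernelR)
open B7Prop2SpecialUnitary (specialUnitaryUnits)
open B9B8AveragingJunction (parKnitY parKnitY_one)
open B9Ineq349SiteReading (opsYS349OfLetters)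
open B9Eq3132NuReading (opsYS349NuOfLetters)
open OpsYQLetter (QLetterY QsLetterY QFamY QsFamY qKnitOfRecord qsKnitOfRecord)
open scoped Matrix

noncomputable section

variable {d ℓ : ℕ} {hd : 1 ≤ d + 1} {hL : Odd (ℓ + 1) ∧ 1 < ℓ + 1} {b₀ b₁ : ℝ} {Mstar : ℕ}

/-! ## §1 `CovLettersY.withParS`: reset ONLY the Hölder site transporter of a letter family -/

section WithParS

variable {𝔸 : Type} [NormedRing 𝔸] [NormedAlgebra ℂ 𝔸] [CompleteSpace 𝔸]
variable {x : MemberY d ℓ hd hL b₀ b₁ Mstar}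

/-- ★ RESET THE HÖLDER SITE TRANSPORTER of a letter family to `parH` (print's shortest contours (3.40)), keeping every other letter: the field `parS` is read
by the operator layer ONLY as the transporter of the Hölder difference quotients (3.41)–(3.45) of the `G′` kernel family; the averaging contours of
(3.19)∕(3.21) live inside the composite letters and are untouched. [cite: Balaban1985BackgroundPropagators, (3.40)–(3.45) pp.397–398, (3.19) p.393] -/
def CovLettersY.withParS (𝔏 : CovLettersY 𝔸 x) (parH : SiteParY 𝔸 x.toKIdx) (hparH : ∀ z z', parH (fun _ _ => 1) z z' = 1) : CovLettersY 𝔸 x :=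
  { 𝔏 with
    parS := parH
    parS_one := hparH }

variable (𝔏 : CovLettersY 𝔸 x) (parH : SiteParY 𝔸 x.toKIdx) (hparH : ∀ z z', parH (fun _ _ => 1) z z' = 1)

/-- the reset Hölder transporter. [cite: Balaban1985BackgroundPropagators, (3.40) p.397, bookkeeping] -/
theorem CovLettersY.withParS_parS : (𝔏.withParS parH hparH).parS = parH := rfl
/-- the bond transporter is kept. [cite: Balaban1985BackgroundPropagators, (3.40) p.397, bookkeeping] -/
theorem CovLettersY.withParS_parB : (𝔏.withParS parH hparH).parB = 𝔏.parB := rfl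
/-- `G′` is kept (its averaging contours live inside the letter). [cite: Balaban1985BackgroundPropagators, (3.25) p.394, bookkeeping] -/
theorem CovLettersY.withParS_Gp : (𝔏.withParS parH hparH).Gp = 𝔏.Gp := rfl
/-- `G` is kept. [cite: Balaban1985BackgroundPropagators, (3.27) p.395, bookkeeping] -/
theorem CovLettersY.withParS_GA : (𝔏.withParS parH hparH).GA = 𝔏.GA := rfl
/-- `C` is kept. [cite: Balaban1985BackgroundPropagators, (3.48) p.398, bookkeeping] -/
theorem CovLettersY.withParS_C : (𝔏.withParS parH hparH).C = 𝔏.C := rfl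
/-- `G̃` is kept. [cite: Balaban1985BackgroundPropagators, (3.122) p.420, bookkeeping] -/
theorem CovLettersY.withParS_GD : (𝔏.withParS parH hparH).GD = 𝔏.GD := rfl
/-- `G₁` is kept. [cite: Balaban1985BackgroundPropagators, (3.137) p.423, bookkeeping] -/
theorem CovLettersY.withParS_G₁ : (𝔏.withParS parH hparH).G₁ = 𝔏.G₁ := rfl
/-- `𝔊` is kept. [cite: Balaban1985BackgroundPropagators, (3.153) p.426, bookkeeping] -/
theorem CovLettersY.withParS_GG : (𝔏.withParS parH hparH).GG = 𝔏.GG := rfl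
/-- `Kdiff` is kept. [cite: Balaban1985BackgroundPropagators, (3.154) p.427, bookkeeping] -/
theorem CovLettersY.withParS_Kdiff : (𝔏.withParS parH hparH).Kdiff = 𝔏.Kdiff := rfl
/-- `H` is kept. [cite: Balaban1985BackgroundPropagators, (3.134) p.422, bookkeeping] -/
theorem CovLettersY.withParS_H : (𝔏.withParS parH hparH).H = 𝔏.H := rfl
/-- `H₁` is kept. [cite: Balaban1985BackgroundPropagators, (3.147) p.425, bookkeeping] -/
theorem CovLettersY.withParS_H₁ : (𝔏.withParS parH hparH).H₁ = 𝔏.H₁ := rfl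
/-- `C^{(k)}` is kept. [cite: Balaban1985BackgroundPropagators, (3.187) p.432, bookkeeping] -/
theorem CovLettersY.withParS_Ck : (𝔏.withParS parH hparH).Ck = 𝔏.Ck := rfl
/-- `(QG̃Q*)⁻¹` is kept. [cite: Balaban1985BackgroundPropagators, (3.132) p.422, bookkeeping] -/
theorem CovLettersY.withParS_QGQinv : (𝔏.withParS parH hparH).QGQinv = 𝔏.QGQinv := rfl
/-- `(QG₁Q*)⁻¹` is kept. [cite: Balaban1985BackgroundPropagators, (3.147) p.425, bookkeeping] -/
theorem CovLettersY.withParS_QG1Qinv : (𝔏.withParS parH hparH).QG1Qinv = 𝔏.QG1Qinv := rfl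
/-- the (3.49) letter is kept. [cite: Balaban1985BackgroundPropagators, (3.49) p.399, bookkeeping] -/
theorem CovLettersY.withParS_P349 : (𝔏.withParS parH hparH).P349 = 𝔏.P349 := rfl

end WithParS

/-! ## §2 ★★★ The v11H letters of record: knit averaging contours, Hölder transporter `parSymY` -/

section Record

open scoped Matrix.Norms.L2Operator

/-- ★★★ **THE v11H LETTERS OF RECORD** over an averaging pair family `(𝔮, 𝔮⋆)` flat at `U = 1` and a residual family `𝔯`: the v11 letters of record
(`lettersYOfRecordV11`: knit averaging contours `parKnitY` in every composite) with the HÖLDER transporter reset to print's shortest contours `parSymY`.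
[cite: Balaban1985BackgroundPropagators, (3.19) p.393, (3.40) p.397, (3.115) p.418, (3.122)–(3.132) pp.420–422] [cite: Balaban1985Averaging, Prop. 2 p.26] -/
def lettersYOfRecordV11H (N : ℕ) (θ : Stage3Params) (Mstar : ℕ) (𝔮 : QFamY N θ) (𝔮s : QsFamY N θ)
    (h𝔮 : ∀ i, 𝔮 i (fun _ _ => 1) = liftMatY (Matrix (Fin N) (Fin N) ℂ) (qK i))
    (h𝔮s : ∀ i, 𝔮s i (fun _ _ => 1) = liftMatY (Matrix (Fin N) (Fin N) ℂ) (qsK i)) (𝔯 : ResY N θ Mstar) : LettersY N θ Mstar :=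
  fun x => (lettersYOfRecordV11 N θ Mstar 𝔮 𝔮s h𝔮 h𝔮s 𝔯 x).withParS (parSymY x.toKIdx) (fun z z' => parSymY_one x.toKIdx z z')

variable (N : ℕ) (θ : Stage3Params) (Mstar : ℕ) (𝔮 : QFamY N θ) (𝔮s : QsFamY N θ)
  (h𝔮 : ∀ i, 𝔮 i (fun _ _ => 1) = liftMatY (Matrix (Fin N) (Fin N) ℂ) (qK i))
  (h𝔮s : ∀ i, 𝔮s i (fun _ _ => 1) = liftMatY (Matrix (Fin N) (Fin N) ℂ) (qsK i)) (𝔯 : ResY N θ Mstar)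

/-- the v11H letters at a member, unfolded (`rfl`). [cite: Balaban1985BackgroundPropagators, (3.40) p.397, bookkeeping] -/
theorem lettersYOfRecordV11H_apply (x : MemberY θ.d₆ θ.ℓ₆ θ.hd' θ.hL' θ.b₀ θ.b₁ Mstar) :
    lettersYOfRecordV11H N θ Mstar 𝔮 𝔮s h𝔮 h𝔮s 𝔯 x =
      (lettersYOfRecordV11 N θ Mstar 𝔮 𝔮s h𝔮 h𝔮s 𝔯 x).withParS (parSymY x.toKIdx) (fun z z' => parSymY_one x.toKIdx z z') := rfl

/-- ★ the two transporters of the v11H record, by name: HÖLDER site transporter `parSymY` (shortest contours, (3.40)), taxicab bond transporter `parBY`.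
[cite: Balaban1985BackgroundPropagators, (3.40) p.397, bookkeeping] -/
theorem lettersYOfRecordV11H_par (x : MemberY θ.d₆ θ.ℓ₆ θ.hd' θ.hL' θ.b₀ θ.b₁ Mstar) :
    (lettersYOfRecordV11H N θ Mstar 𝔮 𝔮s h𝔮 h𝔮s 𝔯 x).parS = parSymY x.toKIdx ∧
      (lettersYOfRecordV11H N θ Mstar 𝔮 𝔮s h𝔮 h𝔮s 𝔯 x).parB = parBY x.toKIdx := ⟨rfl, rfl⟩

/-- ★★ TRANSFER: the thirteen operator letters of the v11H record ARE the v11 record's (`rfl`) — every `lettersYOfRecordV11_…` row applies after these rewrites.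
[cite: Balaban1985BackgroundPropagators, (3.25)–(3.27) pp.394–395, (3.48) p.398, (3.122)–(3.154) pp.420–427, (3.187) p.432, bookkeeping] -/
theorem lettersYOfRecordV11H_letters (x : MemberY θ.d₆ θ.ℓ₆ θ.hd' θ.hL' θ.b₀ θ.b₁ Mstar) :
    (lettersYOfRecordV11H N θ Mstar 𝔮 𝔮s h𝔮 h𝔮s 𝔯 x).Gp = (lettersYOfRecordV11 N θ Mstar 𝔮 𝔮s h𝔮 h𝔮s 𝔯 x).Gp ∧
      (lettersYOfRecordV11H N θ Mstar 𝔮 𝔮s h𝔮 h𝔮s 𝔯 x).GA = (lettersYOfRecordV11 N θ Mstar 𝔮 𝔮s h𝔮 h𝔮s 𝔯 x).GA ∧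
      (lettersYOfRecordV11H N θ Mstar 𝔮 𝔮s h𝔮 h𝔮s 𝔯 x).C = (lettersYOfRecordV11 N θ Mstar 𝔮 𝔮s h𝔮 h𝔮s 𝔯 x).C ∧
      (lettersYOfRecordV11H N θ Mstar 𝔮 𝔮s h𝔮 h𝔮s 𝔯 x).GD = (lettersYOfRecordV11 N θ Mstar 𝔮 𝔮s h𝔮 h𝔮s 𝔯 x).GD ∧
      (lettersYOfRecordV11H N θ Mstar 𝔮 𝔮s h𝔮 h𝔮s 𝔯 x).G₁ = (lettersYOfRecordV11 N θ Mstar 𝔮 𝔮s h𝔮 h𝔮s 𝔯 x).G₁ ∧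
      (lettersYOfRecordV11H N θ Mstar 𝔮 𝔮s h𝔮 h𝔮s 𝔯 x).GG = (lettersYOfRecordV11 N θ Mstar 𝔮 𝔮s h𝔮 h𝔮s 𝔯 x).GG ∧
      (lettersYOfRecordV11H N θ Mstar 𝔮 𝔮s h𝔮 h𝔮s 𝔯 x).Kdiff = (lettersYOfRecordV11 N θ Mstar 𝔮 𝔮s h𝔮 h𝔮s 𝔯 x).Kdiff ∧
      (lettersYOfRecordV11H N θ Mstar 𝔮 𝔮s h𝔮 h𝔮s 𝔯 x).H = (lettersYOfRecordV11 N θ Mstar 𝔮 𝔮s h𝔮 h𝔮s 𝔯 x).H ∧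
      (lettersYOfRecordV11H N θ Mstar 𝔮 𝔮s h𝔮 h𝔮s 𝔯 x).H₁ = (lettersYOfRecordV11 N θ Mstar 𝔮 𝔮s h𝔮 h𝔮s 𝔯 x).H₁ ∧
      (lettersYOfRecordV11H N θ Mstar 𝔮 𝔮s h𝔮 h𝔮s 𝔯 x).Ck = (lettersYOfRecordV11 N θ Mstar 𝔮 𝔮s h𝔮 h𝔮s 𝔯 x).Ck ∧
      (lettersYOfRecordV11H N θ Mstar 𝔮 𝔮s h𝔮 h𝔮s 𝔯 x).QGQinv = (lettersYOfRecordV11 N θ Mstar 𝔮 𝔮s h𝔮 h𝔮s 𝔯 x).QGQinv ∧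
      (lettersYOfRecordV11H N θ Mstar 𝔮 𝔮s h𝔮 h𝔮s 𝔯 x).QG1Qinv = (lettersYOfRecordV11 N θ Mstar 𝔮 𝔮s h𝔮 h𝔮s 𝔯 x).QG1Qinv ∧
      (lettersYOfRecordV11H N θ Mstar 𝔮 𝔮s h𝔮 h𝔮s 𝔯 x).P349 = (lettersYOfRecordV11 N θ Mstar 𝔮 𝔮s h𝔮 h𝔮s 𝔯 x).P349 :=
  ⟨rfl, rfl, rfl, rfl, rfl, rfl, rfl, rfl, rfl, rfl, rfl, rfl, rfl⟩

/-- ★ the pair-independent operator letters of the v11H record, by name: `G′ = GpY (parKnitY)` and `C = (Q′G′²Q′*)⁻¹` over the KNIT averaging contours.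
[cite: Balaban1985BackgroundPropagators, (3.24)–(3.25) p.394, (3.48) p.398] [cite: Balaban1985Averaging, Prop. 2 p.26] -/
theorem lettersYOfRecordV11H_base (x : MemberY θ.d₆ θ.ℓ₆ θ.hd' θ.hL' θ.b₀ θ.b₁ Mstar) :
    (lettersYOfRecordV11H N θ Mstar 𝔮 𝔮s h𝔮 h𝔮s 𝔯 x).Gp = GpY x.toKIdx (parKnitY x.toKIdx) ∧
      (lettersYOfRecordV11H N θ Mstar 𝔮 𝔮s h𝔮 h𝔮s 𝔯 x).C = CY x.toKIdx (parKnitY x.toKIdx) (GpY x.toKIdx (parKnitY x.toKIdx)) := ⟨rfl, rfl⟩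

/-- ★ the Sect. B∕D∕E composites of the v11H record, by name: OVER THE PAIR `(𝔮 x, 𝔮⋆ x)` and the KNIT averaging contours, fed `G′_phys`; `GA = G[𝔮 x]` fed `G′_latt`.
[cite: Balaban1985BackgroundPropagators, (3.27) p.395, (3.122)–(3.132) pp.420–422, (3.147) p.425, (3.153) p.426] -/
theorem lettersYOfRecordV11H_sectDE (x : MemberY θ.d₆ θ.ℓ₆ θ.hd' θ.hL' θ.b₀ θ.b₁ Mstar) :
    (lettersYOfRecordV11H N θ Mstar 𝔮 𝔮s h𝔮 h𝔮s 𝔯 x).GD =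
        GDQY x.toKIdx (𝔮 x.toKIdx) (𝔮s x.toKIdx) (parKnitY x.toKIdx) (GpPhysY x.toKIdx (parKnitY x.toKIdx)) ∧
      (lettersYOfRecordV11H N θ Mstar 𝔮 𝔮s h𝔮 h𝔮s 𝔯 x).QGQinv =
        QGQinvQY x.toKIdx (𝔮 x.toKIdx) (𝔮s x.toKIdx) (parKnitY x.toKIdx) (GpPhysY x.toKIdx (parKnitY x.toKIdx)) ∧
      (lettersYOfRecordV11H N θ Mstar 𝔮 𝔮s h𝔮 h𝔮s 𝔯 x).H =
        HDQY x.toKIdx (𝔮 x.toKIdx) (𝔮s x.toKIdx) (parKnitY x.toKIdx) (GpPhysY x.toKIdx (parKnitY x.toKIdx)) ∧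
      (lettersYOfRecordV11H N θ Mstar 𝔮 𝔮s h𝔮 h𝔮s 𝔯 x).G₁ =
        G1QY x.toKIdx (𝔮 x.toKIdx) (𝔮s x.toKIdx) (parKnitY x.toKIdx) (GpPhysY x.toKIdx (parKnitY x.toKIdx)) (𝔯 x).Δ2 ∧
      (lettersYOfRecordV11H N θ Mstar 𝔮 𝔮s h𝔮 h𝔮s 𝔯 x).QG1Qinv =
        QG1QinvQY x.toKIdx (𝔮 x.toKIdx) (𝔮s x.toKIdx) (parKnitY x.toKIdx) (GpPhysY x.toKIdx (parKnitY x.toKIdx)) (𝔯 x).Δ2 ∧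
      (lettersYOfRecordV11H N θ Mstar 𝔮 𝔮s h𝔮 h𝔮s 𝔯 x).H₁ =
        H1QY x.toKIdx (𝔮 x.toKIdx) (𝔮s x.toKIdx) (parKnitY x.toKIdx) (GpPhysY x.toKIdx (parKnitY x.toKIdx)) (𝔯 x).Δ2 ∧
      (lettersYOfRecordV11H N θ Mstar 𝔮 𝔮s h𝔮 h𝔮s 𝔯 x).GG =
        GGQY x.toKIdx (𝔮 x.toKIdx) (𝔮s x.toKIdx) (parKnitY x.toKIdx) (GpPhysY x.toKIdx (parKnitY x.toKIdx)) (𝔯 x).Δ2 ∧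
      (lettersYOfRecordV11H N θ Mstar 𝔮 𝔮s h𝔮 h𝔮s 𝔯 x).GA =
        GAQY x.toKIdx (𝔮 x.toKIdx) (𝔮s x.toKIdx) (parKnitY x.toKIdx) (GpY x.toKIdx (parKnitY x.toKIdx)) :=
  ⟨rfl, rfl, rfl, rfl, rfl, rfl, rfl, rfl⟩

/-- ★ the v11H record's `GA = G[𝔮 x]` is ALSO the composite fed `G′_phys`. [cite: Balaban1985BackgroundPropagators, (3.26)–(3.27) p.395, (3.25) p.394] -/
theorem lettersYOfRecordV11H_GA_phys (x : MemberY θ.d₆ θ.ℓ₆ θ.hd' θ.hL' θ.b₀ θ.b₁ Mstar) :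
    (lettersYOfRecordV11H N θ Mstar 𝔮 𝔮s h𝔮 h𝔮s 𝔯 x).GA =
      GAQY x.toKIdx (𝔮 x.toKIdx) (𝔮s x.toKIdx) (parKnitY x.toKIdx) (GpPhysY x.toKIdx (parKnitY x.toKIdx)) :=
  (GAQY_GpPhysY x.toKIdx (𝔮 x.toKIdx) (𝔮s x.toKIdx) (parKnitY x.toKIdx)).symm

/-! ## §3 ★★★ The v11H star instances of record -/

/-- ★★★ **THE v11H STAR INSTANCE OF RECORD** over an averaging pair family: `opsYSectESt … (opsYS349OfLetters … 𝔏 𝔈) 𝔏 𝔢 𝔴` at `𝔏 := lettersYOfRecordV11H …`.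
[cite: Balaban1985BackgroundPropagators, Thms 3.1–3.15 pp.397–432, (3.40) p.397, (3.115) p.418, (3.156)–(3.158) p.428; Balaban1984PropagatorsII, (2.3) p.224] -/
def opsYStOfRecordV11HE (N : ℕ) (θ : Stage3Params) (Mstar : ℕ) (𝔮 : QFamY N θ) (𝔮s : QsFamY N θ)
    (h𝔮 : ∀ i, 𝔮 i (fun _ _ => 1) = liftMatY (Matrix (Fin N) (Fin N) ℂ) (qK i))
    (h𝔮s : ∀ i, 𝔮s i (fun _ _ => 1) = liftMatY (Matrix (Fin N) (Fin N) ℂ) (qsK i)) (𝔯 : ResY N θ Mstar) (𝔢 : SectEStY N θ Mstar)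
    (𝔴 : RWEY N θ Mstar) (𝔈 : ExpsY N θ Mstar) : OpsY N θ Mstar :=
  opsYSectESt N θ Mstar (opsYS349OfLetters N θ Mstar (lettersYOfRecordV11H N θ Mstar 𝔮 𝔮s h𝔮 h𝔮s 𝔯) 𝔈)
    (lettersYOfRecordV11H N θ Mstar 𝔮 𝔮s h𝔮 h𝔮s 𝔯) 𝔢 𝔴

/-- ★★★ **THE v11H STAR INSTANCE OF RECORD WITH ROW 26 `ν`-READ** over an averaging pair family: `opsYSectESt … (opsYS349NuOfLetters … 𝔏 𝔈) 𝔏 𝔢 𝔴` at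
`𝔏 := lettersYOfRecordV11H …` — the shape the N06 certificate of record reads.
[cite: Balaban1985BackgroundPropagators, Thms 3.1–3.15 pp.397–432, (3.40) p.397, (3.115) p.418, (3.132) p.422; Balaban1984PropagatorsII, (2.3) p.224] -/
def opsYNuStOfRecordV11HE (N : ℕ) (θ : Stage3Params) (Mstar : ℕ) (𝔮 : QFamY N θ) (𝔮s : QsFamY N θ)
    (h𝔮 : ∀ i, 𝔮 i (fun _ _ => 1) = liftMatY (Matrix (Fin N) (Fin N) ℂ) (qK i))
    (h𝔮s : ∀ i, 𝔮s i (fun _ _ => 1) = liftMatY (Matrix (Fin N) (Fin N) ℂ) (qsK i)) (𝔯 : ResY N θ Mstar) (𝔢 : SectEStY N θ Mstar)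
    (𝔴 : RWEY N θ Mstar) (𝔈 : ExpsY N θ Mstar) : OpsY N θ Mstar :=
  opsYSectESt N θ Mstar (opsYS349NuOfLetters N θ Mstar (lettersYOfRecordV11H N θ Mstar 𝔮 𝔮s h𝔮 h𝔮s 𝔯) 𝔈)
    (lettersYOfRecordV11H N θ Mstar 𝔮 𝔮s h𝔮 h𝔮s 𝔯) 𝔢 𝔴

variable (𝔢 : SectEStY N θ Mstar) (𝔴 : RWEY N θ Mstar) (𝔈 : ExpsY N θ Mstar)
  (R₁ R₂ : RegFamY θ.d₆ θ.ℓ₆ θ.hd' θ.hL' θ.b₀ θ.b₁ Mstar (Matrix (Fin N) (Fin N) ℂ))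

/-! ## §4 ★★★ The three LEAF PINS at the v11H instances, split shape `(parA, parH) = (parKnitY, parSymY)` -/

/-- ★★★ LEAF PIN `hGpPin` at the `ν`-read v11H instance: its `G′` kernel family, re-based on a (3.35)∕(3.36) class family, IS the sup∕Hölder reading of
`G′ = GpY (parKnitY)` (KNIT averaging contours) with HÖLDER transporter `parSymY` (shortest contours). [cite: Balaban1985BackgroundPropagators, Thm 3.1 (3.41)–(3.45) pp.397–398] -/
theorem opsYNuStOfRecordV11HE_GpPin (x : MemberY θ.d₆ θ.ℓ₆ θ.hd' θ.hL' θ.b₀ θ.b₁ Mstar) :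
    kernelFamilyR R₁ R₂ (opsYNuStOfRecordV11HE N θ Mstar 𝔮 𝔮s h𝔮 h𝔮s 𝔯 𝔢 𝔴 𝔈 x).Gp =
      kernelFamilyS x.toKIdx (bg9YR (Matrix (Fin N) (Fin N) ℂ) (specialUnitaryUnits (Fin N)) R₁ R₂ x) (fun U => U)
        (GpY x.toKIdx (parKnitY x.toKIdx)) (parSymY x.toKIdx) := rfl

/-- ★★★ LEAF PIN `hGAPin` at the `ν`-read v11H instance: its `G` kernel family IS the reading of `G[𝔮 x](parKnitY, G′_latt)` with bond transporter `parBY`.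
[cite: Balaban1985BackgroundPropagators, Thm 3.3 (3.51)–(3.56) pp.399–400, (3.27) p.395] -/
theorem opsYNuStOfRecordV11HE_GAPin (x : MemberY θ.d₆ θ.ℓ₆ θ.hd' θ.hL' θ.b₀ θ.b₁ Mstar) :
    kernelFamilyR R₁ R₂ (opsYNuStOfRecordV11HE N θ Mstar 𝔮 𝔮s h𝔮 h𝔮s 𝔯 𝔢 𝔴 𝔈 x).GA =
      kernelFamilyB x.toKIdx (bg9YR (Matrix (Fin N) (Fin N) ℂ) (specialUnitaryUnits (Fin N)) R₁ R₂ x) (fun U => U)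
        (GAQY x.toKIdx (𝔮 x.toKIdx) (𝔮s x.toKIdx) (parKnitY x.toKIdx) (GpY x.toKIdx (parKnitY x.toKIdx))) (parBY x.toKIdx) := rfl

/-- ★ the same pin with `G[𝔮 x]` fed `G′_phys`. [cite: Balaban1985BackgroundPropagators, Thm 3.3 p.399, (3.25)–(3.27) pp.394–395] -/
theorem opsYNuStOfRecordV11HE_GAPin_phys (x : MemberY θ.d₆ θ.ℓ₆ θ.hd' θ.hL' θ.b₀ θ.b₁ Mstar) :
    kernelFamilyR R₁ R₂ (opsYNuStOfRecordV11HE N θ Mstar 𝔮 𝔮s h𝔮 h𝔮s 𝔯 𝔢 𝔴 𝔈 x).GA =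
      kernelFamilyB x.toKIdx (bg9YR (Matrix (Fin N) (Fin N) ℂ) (specialUnitaryUnits (Fin N)) R₁ R₂ x) (fun U => U)
        (GAQY x.toKIdx (𝔮 x.toKIdx) (𝔮s x.toKIdx) (parKnitY x.toKIdx) (GpPhysY x.toKIdx (parKnitY x.toKIdx))) (parBY x.toKIdx) := by
  rw [GAQY_GpPhysY]; rfl

/-- ★★★ LEAF PIN `hCinvPin` at the `ν`-read v11H instance: its `Cinv` site kernel, re-based, IS the block kernel of `C(U) = (Q′G′²Q′*)⁻¹` over the KNIT averaging
contours (= `CinvY P f G (fun j => parKnitY (f j)) j` at the coded class family, by unfolding). [cite: Balaban1985BackgroundPropagators, Thm 3.2 (3.48) p.398] -/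
theorem opsYNuStOfRecordV11HE_CinvPin (x : MemberY θ.d₆ θ.ℓ₆ θ.hd' θ.hL' θ.b₀ θ.b₁ Mstar) :
    siteKernelR R₁ R₂ (opsYNuStOfRecordV11HE N θ Mstar 𝔮 𝔮s h𝔮 h𝔮s 𝔯 𝔢 𝔴 𝔈 x).Cinv =
      siteKernelOfOp x.toKIdx (bg9YR (Matrix (Fin N) (Fin N) ℂ) (specialUnitaryUnits (Fin N)) R₁ R₂ x) (fun U => U)
        (CY x.toKIdx (parKnitY x.toKIdx) (GpY x.toKIdx (parKnitY x.toKIdx))) (β x.hN x.D x.hk) (β x.hN x.D x.hk) := rfl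

/-- ★ LEAF PIN `hGpPin` at the PLAIN v11H instance (same family). [cite: Balaban1985BackgroundPropagators, Thm 3.1 (3.41)–(3.45) pp.397–398] -/
theorem opsYStOfRecordV11HE_GpPin (x : MemberY θ.d₆ θ.ℓ₆ θ.hd' θ.hL' θ.b₀ θ.b₁ Mstar) :
    kernelFamilyR R₁ R₂ (opsYStOfRecordV11HE N θ Mstar 𝔮 𝔮s h𝔮 h𝔮s 𝔯 𝔢 𝔴 𝔈 x).Gp =
      kernelFamilyS x.toKIdx (bg9YR (Matrix (Fin N) (Fin N) ℂ) (specialUnitaryUnits (Fin N)) R₁ R₂ x) (fun U => U)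
        (GpY x.toKIdx (parKnitY x.toKIdx)) (parSymY x.toKIdx) := rfl

/-- ★ LEAF PIN `hGAPin` at the PLAIN v11H instance. [cite: Balaban1985BackgroundPropagators, Thm 3.3 p.399, (3.27) p.395] -/
theorem opsYStOfRecordV11HE_GAPin (x : MemberY θ.d₆ θ.ℓ₆ θ.hd' θ.hL' θ.b₀ θ.b₁ Mstar) :
    kernelFamilyR R₁ R₂ (opsYStOfRecordV11HE N θ Mstar 𝔮 𝔮s h𝔮 h𝔮s 𝔯 𝔢 𝔴 𝔈 x).GA =
      kernelFamilyB x.toKIdx (bg9YR (Matrix (Fin N) (Fin N) ℂ) (specialUnitaryUnits (Fin N)) R₁ R₂ x) (fun U => U)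
        (GAQY x.toKIdx (𝔮 x.toKIdx) (𝔮s x.toKIdx) (parKnitY x.toKIdx) (GpY x.toKIdx (parKnitY x.toKIdx))) (parBY x.toKIdx) := rfl

/-- ★ LEAF PIN `hCinvPin` at the PLAIN v11H instance. [cite: Balaban1985BackgroundPropagators, Thm 3.2 (3.48) p.398] -/
theorem opsYStOfRecordV11HE_CinvPin (x : MemberY θ.d₆ θ.ℓ₆ θ.hd' θ.hL' θ.b₀ θ.b₁ Mstar) :
    siteKernelR R₁ R₂ (opsYStOfRecordV11HE N θ Mstar 𝔮 𝔮s h𝔮 h𝔮s 𝔯 𝔢 𝔴 𝔈 x).Cinv =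
      siteKernelOfOp x.toKIdx (bg9YR (Matrix (Fin N) (Fin N) ℂ) (specialUnitaryUnits (Fin N)) R₁ R₂ x) (fun U => U)
        (CY x.toKIdx (parKnitY x.toKIdx) (GpY x.toKIdx (parKnitY x.toKIdx))) (β x.hN x.D x.hk) (β x.hN x.D x.hk) := rfl

end Record

/-! ## §5 ★★★ The KNIT-PAIR instances: `lettersYOfRecordV11KH`, `opsYStOfRecordV11KHE ∕ opsYNuStOfRecordV11KHE`, and their leaf pins -/

section RecordKnit

open scoped Matrix.Norms.L2Operator

/-- ★★★ **THE KNIT LETTERS OF RECORD WITH PRINT's HÖLDER TRANSPORTER** `:=` the v11H letters at the knit pair `(qKnitOfRecord, qsKnitOfRecord)`: print's `Q` of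
(3.115) and the knit averaging contours in every composite, Hölder quotients over shortest contours. THE CANDIDATE LETTERS OF RECORD for the re-keyed N06 certificate.
[cite: Balaban1985BackgroundPropagators, (3.40) p.397, (3.115) p.418, (3.122)–(3.132) pp.420–422] [cite: Balaban1985Averaging, (15)–(23) pp.19–21, Prop. 2 p.26] -/
def lettersYOfRecordV11KH (N : ℕ) [Nonempty (Fin N)] (θ : Stage3Params) (Mstar : ℕ) (𝔯 : ResY N θ Mstar) : LettersY N θ Mstar :=
  lettersYOfRecordV11H N θ Mstar (qKnitOfRecord N θ) (qsKnitOfRecord N θ) (qKnitOfRecord_flat N θ) (qsKnitOfRecord_flat N θ) 𝔯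

/-- ★★★ **THE PLAIN v11H STAR INSTANCE OF RECORD AT THE KNIT PAIR.** [cite: Balaban1985BackgroundPropagators, Thms 3.1–3.15 pp.397–432, (3.40) p.397, (3.115) p.418] -/
def opsYStOfRecordV11KHE (N : ℕ) [Nonempty (Fin N)] (θ : Stage3Params) (Mstar : ℕ) (𝔯 : ResY N θ Mstar) (𝔢 : SectEStY N θ Mstar)
    (𝔴 : RWEY N θ Mstar) (𝔈 : ExpsY N θ Mstar) : OpsY N θ Mstar :=
  opsYStOfRecordV11HE N θ Mstar (qKnitOfRecord N θ) (qsKnitOfRecord N θ) (qKnitOfRecord_flat N θ) (qsKnitOfRecord_flat N θ) 𝔯 𝔢 𝔴 𝔈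

/-- ★★★ **THE `ν`-READ v11H STAR INSTANCE OF RECORD AT THE KNIT PAIR** — the candidate OBJECT OF RECORD of the re-keyed N06 certificate (CASCADE-K K3).
[cite: Balaban1985BackgroundPropagators, Thms 3.1–3.15 pp.397–432, (3.40) p.397, (3.115) p.418, (3.132) p.422] [cite: Balaban1985Averaging, (15) p.19] -/
def opsYNuStOfRecordV11KHE (N : ℕ) [Nonempty (Fin N)] (θ : Stage3Params) (Mstar : ℕ) (𝔯 : ResY N θ Mstar) (𝔢 : SectEStY N θ Mstar)
    (𝔴 : RWEY N θ Mstar) (𝔈 : ExpsY N θ Mstar) : OpsY N θ Mstar :=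
  opsYNuStOfRecordV11HE N θ Mstar (qKnitOfRecord N θ) (qsKnitOfRecord N θ) (qKnitOfRecord_flat N θ) (qsKnitOfRecord_flat N θ) 𝔯 𝔢 𝔴 𝔈

variable (N : ℕ) [Nonempty (Fin N)] (θ : Stage3Params) (Mstar : ℕ) (𝔯 : ResY N θ Mstar) (𝔢 : SectEStY N θ Mstar) (𝔴 : RWEY N θ Mstar)
  (𝔈 : ExpsY N θ Mstar) (R₁ R₂ : RegFamY θ.d₆ θ.ℓ₆ θ.hd' θ.hL' θ.b₀ θ.b₁ Mstar (Matrix (Fin N) (Fin N) ℂ))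

/-- the knit v11H letters ARE the v11H letters at the knit pair (`rfl`; every `lettersYOfRecordV11H_…` face applies after this rewrite).
[cite: Balaban1985BackgroundPropagators, (3.115) p.418, bookkeeping] -/
theorem lettersYOfRecordV11KH_eq : lettersYOfRecordV11KH N θ Mstar 𝔯 =
    lettersYOfRecordV11H N θ Mstar (qKnitOfRecord N θ) (qsKnitOfRecord N θ) (qKnitOfRecord_flat N θ) (qsKnitOfRecord_flat N θ) 𝔯 := rfl

/-- the knit v11H letters at a member `=` the knit v11 letters with the Hölder transporter reset (`rfl`). [cite: Balaban1985BackgroundPropagators, (3.40) p.397, bookkeeping] -/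
theorem lettersYOfRecordV11KH_apply (x : MemberY θ.d₆ θ.ℓ₆ θ.hd' θ.hL' θ.b₀ θ.b₁ Mstar) :
    lettersYOfRecordV11KH N θ Mstar 𝔯 x = (lettersYOfRecordV11K N θ Mstar 𝔯 x).withParS (parSymY x.toKIdx) (fun z z' => parSymY_one x.toKIdx z z') := rfl

/-- ★ the two transporters of the knit v11H record: Hölder `parSymY`, bond `parBY`. [cite: Balaban1985BackgroundPropagators, (3.40) p.397, bookkeeping] -/
theorem lettersYOfRecordV11KH_par (x : MemberY θ.d₆ θ.ℓ₆ θ.hd' θ.hL' θ.b₀ θ.b₁ Mstar) :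
    (lettersYOfRecordV11KH N θ Mstar 𝔯 x).parS = parSymY x.toKIdx ∧ (lettersYOfRecordV11KH N θ Mstar 𝔯 x).parB = parBY x.toKIdx := ⟨rfl, rfl⟩

/-- ★★ TRANSFER: the thirteen operator letters of the knit v11H record ARE the knit v11 record's (`rfl`) — every `lettersYOfRecordV11K_…` row of `OpsYRecordV11 ∕
OpsYRecordV11Reg335 ∕ OpsYRecordV11Thresh` applies verbatim after these rewrites.
[cite: Balaban1985BackgroundPropagators, (3.25)–(3.27) pp.394–395, (3.122)–(3.154) pp.420–427, bookkeeping] -/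
theorem lettersYOfRecordV11KH_letters (x : MemberY θ.d₆ θ.ℓ₆ θ.hd' θ.hL' θ.b₀ θ.b₁ Mstar) :
    (lettersYOfRecordV11KH N θ Mstar 𝔯 x).Gp = (lettersYOfRecordV11K N θ Mstar 𝔯 x).Gp ∧
      (lettersYOfRecordV11KH N θ Mstar 𝔯 x).GA = (lettersYOfRecordV11K N θ Mstar 𝔯 x).GA ∧
      (lettersYOfRecordV11KH N θ Mstar 𝔯 x).C = (lettersYOfRecordV11K N θ Mstar 𝔯 x).C ∧
      (lettersYOfRecordV11KH N θ Mstar 𝔯 x).GD = (lettersYOfRecordV11K N θ Mstar 𝔯 x).GD ∧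
      (lettersYOfRecordV11KH N θ Mstar 𝔯 x).G₁ = (lettersYOfRecordV11K N θ Mstar 𝔯 x).G₁ ∧
      (lettersYOfRecordV11KH N θ Mstar 𝔯 x).GG = (lettersYOfRecordV11K N θ Mstar 𝔯 x).GG ∧
      (lettersYOfRecordV11KH N θ Mstar 𝔯 x).Kdiff = (lettersYOfRecordV11K N θ Mstar 𝔯 x).Kdiff ∧
      (lettersYOfRecordV11KH N θ Mstar 𝔯 x).H = (lettersYOfRecordV11K N θ Mstar 𝔯 x).H ∧
      (lettersYOfRecordV11KH N θ Mstar 𝔯 x).H₁ = (lettersYOfRecordV11K N θ Mstar 𝔯 x).H₁ ∧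
      (lettersYOfRecordV11KH N θ Mstar 𝔯 x).Ck = (lettersYOfRecordV11K N θ Mstar 𝔯 x).Ck ∧
      (lettersYOfRecordV11KH N θ Mstar 𝔯 x).QGQinv = (lettersYOfRecordV11K N θ Mstar 𝔯 x).QGQinv ∧
      (lettersYOfRecordV11KH N θ Mstar 𝔯 x).QG1Qinv = (lettersYOfRecordV11K N θ Mstar 𝔯 x).QG1Qinv ∧
      (lettersYOfRecordV11KH N θ Mstar 𝔯 x).P349 = (lettersYOfRecordV11K N θ Mstar 𝔯 x).P349 :=
  ⟨rfl, rfl, rfl, rfl, rfl, rfl, rfl, rfl, rfl, rfl, rfl, rfl, rfl⟩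

/-- the plain knit v11H instance IS the v11H instance at the knit pair (`rfl`). [cite: Balaban1985BackgroundPropagators, (3.115) p.418, Thm 3.15 p.432, bookkeeping] -/
theorem opsYStOfRecordV11KHE_eq : opsYStOfRecordV11KHE N θ Mstar 𝔯 𝔢 𝔴 𝔈 =
    opsYStOfRecordV11HE N θ Mstar (qKnitOfRecord N θ) (qsKnitOfRecord N θ) (qKnitOfRecord_flat N θ) (qsKnitOfRecord_flat N θ) 𝔯 𝔢 𝔴 𝔈 := rfl

/-- the `ν`-read knit v11H instance IS the v11H instance at the knit pair (`rfl`). [cite: Balaban1985BackgroundPropagators, (3.115) p.418, (3.132) p.422, bookkeeping] -/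
theorem opsYNuStOfRecordV11KHE_eq : opsYNuStOfRecordV11KHE N θ Mstar 𝔯 𝔢 𝔴 𝔈 =
    opsYNuStOfRecordV11HE N θ Mstar (qKnitOfRecord N θ) (qsKnitOfRecord N θ) (qKnitOfRecord_flat N θ) (qsKnitOfRecord_flat N θ) 𝔯 𝔢 𝔴 𝔈 := rfl

/-- the plain knit v11H instance as the star constructor over the knit v11H letters (`rfl`). [cite: Balaban1985BackgroundPropagators, Thm 3.15 p.432, bookkeeping] -/
theorem opsYStOfRecordV11KHE_eq_opsYSectESt : opsYStOfRecordV11KHE N θ Mstar 𝔯 𝔢 𝔴 𝔈 =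
    opsYSectESt N θ Mstar (opsYS349OfLetters N θ Mstar (lettersYOfRecordV11KH N θ Mstar 𝔯) 𝔈) (lettersYOfRecordV11KH N θ Mstar 𝔯) 𝔢 𝔴 := rfl

/-- the `ν`-read knit v11H instance as the star constructor over the knit v11H letters (`rfl`). [cite: Balaban1985BackgroundPropagators, Thm 3.15 p.432, (3.132) p.422, bookkeeping] -/
theorem opsYNuStOfRecordV11KHE_eq_opsYSectESt : opsYNuStOfRecordV11KHE N θ Mstar 𝔯 𝔢 𝔴 𝔈 =
    opsYSectESt N θ Mstar (opsYS349NuOfLetters N θ Mstar (lettersYOfRecordV11KH N θ Mstar 𝔯) 𝔈) (lettersYOfRecordV11KH N θ Mstar 𝔯) 𝔢 𝔴 := rfl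

/-- ★★★ LEAF PIN `hGpPin` AT THE OBJECT OF RECORD: `kernelFamilyR R₁ R₂ (ops x).Gp = kernelFamilyS x (bg9YR … x) id (GpY x (parKnitY x)) (parSymY x)` — the
`(parA, parH) = (parKnitY, parSymY)` shape. [cite: Balaban1985BackgroundPropagators, Thm 3.1 (3.41)–(3.45) pp.397–398] [cite: Balaban1985Averaging, Prop. 2 p.26] -/
theorem opsYNuStOfRecordV11KHE_GpPin (x : MemberY θ.d₆ θ.ℓ₆ θ.hd' θ.hL' θ.b₀ θ.b₁ Mstar) :
    kernelFamilyR R₁ R₂ (opsYNuStOfRecordV11KHE N θ Mstar 𝔯 𝔢 𝔴 𝔈 x).Gp =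
      kernelFamilyS x.toKIdx (bg9YR (Matrix (Fin N) (Fin N) ℂ) (specialUnitaryUnits (Fin N)) R₁ R₂ x) (fun U => U)
        (GpY x.toKIdx (parKnitY x.toKIdx)) (parSymY x.toKIdx) := rfl

/-- ★★★ LEAF PIN `hGAPin` AT THE OBJECT OF RECORD: `OA := G[QknitY](parKnitY, G′_latt)`. [cite: Balaban1985BackgroundPropagators, Thm 3.3 p.399, (3.27) p.395, (3.115) p.418] -/
theorem opsYNuStOfRecordV11KHE_GAPin (x : MemberY θ.d₆ θ.ℓ₆ θ.hd' θ.hL' θ.b₀ θ.b₁ Mstar) :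
    kernelFamilyR R₁ R₂ (opsYNuStOfRecordV11KHE N θ Mstar 𝔯 𝔢 𝔴 𝔈 x).GA =
      kernelFamilyB x.toKIdx (bg9YR (Matrix (Fin N) (Fin N) ℂ) (specialUnitaryUnits (Fin N)) R₁ R₂ x) (fun U => U)
        (GAQY x.toKIdx (qKnitOfRecord N θ x.toKIdx) (qsKnitOfRecord N θ x.toKIdx) (parKnitY x.toKIdx) (GpY x.toKIdx (parKnitY x.toKIdx)))
        (parBY x.toKIdx) := rfl

/-- ★ the same pin with `OA := G[QknitY](parKnitY, G′_phys)`. [cite: Balaban1985BackgroundPropagators, Thm 3.3 p.399, (3.25)–(3.27) pp.394–395] -/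
theorem opsYNuStOfRecordV11KHE_GAPin_phys (x : MemberY θ.d₆ θ.ℓ₆ θ.hd' θ.hL' θ.b₀ θ.b₁ Mstar) :
    kernelFamilyR R₁ R₂ (opsYNuStOfRecordV11KHE N θ Mstar 𝔯 𝔢 𝔴 𝔈 x).GA =
      kernelFamilyB x.toKIdx (bg9YR (Matrix (Fin N) (Fin N) ℂ) (specialUnitaryUnits (Fin N)) R₁ R₂ x) (fun U => U)
        (GAQY x.toKIdx (qKnitOfRecord N θ x.toKIdx) (qsKnitOfRecord N θ x.toKIdx) (parKnitY x.toKIdx) (GpPhysY x.toKIdx (parKnitY x.toKIdx)))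
        (parBY x.toKIdx) :=
  opsYNuStOfRecordV11HE_GAPin_phys N θ Mstar (qKnitOfRecord N θ) (qsKnitOfRecord N θ) (qKnitOfRecord_flat N θ) (qsKnitOfRecord_flat N θ) 𝔯 𝔢 𝔴 𝔈
    R₁ R₂ x

/-- ★★★ LEAF PIN `hCinvPin` AT THE OBJECT OF RECORD: the re-based `Cinv` IS the block kernel of `C(U; parKnitY, G′(parKnitY))` (`= CinvY P f G (fun j => parKnitY (f j)) j`
at `R := (regC335, regC336)`, by unfolding). [cite: Balaban1985BackgroundPropagators, Thm 3.2 (3.48) p.398] [cite: Balaban1985Averaging, Prop. 2 p.26] -/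
theorem opsYNuStOfRecordV11KHE_CinvPin (x : MemberY θ.d₆ θ.ℓ₆ θ.hd' θ.hL' θ.b₀ θ.b₁ Mstar) :
    siteKernelR R₁ R₂ (opsYNuStOfRecordV11KHE N θ Mstar 𝔯 𝔢 𝔴 𝔈 x).Cinv =
      siteKernelOfOp x.toKIdx (bg9YR (Matrix (Fin N) (Fin N) ℂ) (specialUnitaryUnits (Fin N)) R₁ R₂ x) (fun U => U)
        (CY x.toKIdx (parKnitY x.toKIdx) (GpY x.toKIdx (parKnitY x.toKIdx))) (β x.hN x.D x.hk) (β x.hN x.D x.hk) := rfl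

/-- ★ LEAF PINS at the PLAIN knit v11H instance (same three right-hand sides). [cite: Balaban1985BackgroundPropagators, Thms 3.1–3.3 pp.397–400] -/
theorem opsYStOfRecordV11KHE_pins (x : MemberY θ.d₆ θ.ℓ₆ θ.hd' θ.hL' θ.b₀ θ.b₁ Mstar) :
    kernelFamilyR R₁ R₂ (opsYStOfRecordV11KHE N θ Mstar 𝔯 𝔢 𝔴 𝔈 x).Gp =
        kernelFamilyS x.toKIdx (bg9YR (Matrix (Fin N) (Fin N) ℂ) (specialUnitaryUnits (Fin N)) R₁ R₂ x) (fun U => U)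
          (GpY x.toKIdx (parKnitY x.toKIdx)) (parSymY x.toKIdx) ∧
      kernelFamilyR R₁ R₂ (opsYStOfRecordV11KHE N θ Mstar 𝔯 𝔢 𝔴 𝔈 x).GA =
        kernelFamilyB x.toKIdx (bg9YR (Matrix (Fin N) (Fin N) ℂ) (specialUnitaryUnits (Fin N)) R₁ R₂ x) (fun U => U)
          (GAQY x.toKIdx (qKnitOfRecord N θ x.toKIdx) (qsKnitOfRecord N θ x.toKIdx) (parKnitY x.toKIdx) (GpY x.toKIdx (parKnitY x.toKIdx)))
          (parBY x.toKIdx) ∧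
      siteKernelR R₁ R₂ (opsYStOfRecordV11KHE N θ Mstar 𝔯 𝔢 𝔴 𝔈 x).Cinv =
        siteKernelOfOp x.toKIdx (bg9YR (Matrix (Fin N) (Fin N) ℂ) (specialUnitaryUnits (Fin N)) R₁ R₂ x) (fun U => U)
          (CY x.toKIdx (parKnitY x.toKIdx) (GpY x.toKIdx (parKnitY x.toKIdx))) (β x.hN x.D x.hk) (β x.hN x.D x.hk) := ⟨rfl, rfl, rfl⟩

/-- ★ the Sect. B∕D∕E composites of the knit v11H record, by name (the certificate's `hGco12 ∕ hG1co12 ∕ hGGco12 ∕ hHm12 ∕ hH1m12` right-hand sides).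
[cite: Balaban1985BackgroundPropagators, (3.27) p.395, (3.115) p.418, (3.122)–(3.132) pp.420–422, (3.153) p.426] [cite: Balaban1985Averaging, (15) p.19] -/
theorem lettersYOfRecordV11KH_sectDE (x : MemberY θ.d₆ θ.ℓ₆ θ.hd' θ.hL' θ.b₀ θ.b₁ Mstar) :
    (lettersYOfRecordV11KH N θ Mstar 𝔯 x).GD =
        GDQY x.toKIdx (qKnitOfRecord N θ x.toKIdx) (qsKnitOfRecord N θ x.toKIdx) (parKnitY x.toKIdx) (GpPhysY x.toKIdx (parKnitY x.toKIdx)) ∧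
      (lettersYOfRecordV11KH N θ Mstar 𝔯 x).QGQinv =
        QGQinvQY x.toKIdx (qKnitOfRecord N θ x.toKIdx) (qsKnitOfRecord N θ x.toKIdx) (parKnitY x.toKIdx) (GpPhysY x.toKIdx (parKnitY x.toKIdx)) ∧
      (lettersYOfRecordV11KH N θ Mstar 𝔯 x).H =
        HDQY x.toKIdx (qKnitOfRecord N θ x.toKIdx) (qsKnitOfRecord N θ x.toKIdx) (parKnitY x.toKIdx) (GpPhysY x.toKIdx (parKnitY x.toKIdx)) ∧
      (lettersYOfRecordV11KH N θ Mstar 𝔯 x).G₁ =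
        G1QY x.toKIdx (qKnitOfRecord N θ x.toKIdx) (qsKnitOfRecord N θ x.toKIdx) (parKnitY x.toKIdx) (GpPhysY x.toKIdx (parKnitY x.toKIdx))
          (𝔯 x).Δ2 ∧
      (lettersYOfRecordV11KH N θ Mstar 𝔯 x).QG1Qinv =
        QG1QinvQY x.toKIdx (qKnitOfRecord N θ x.toKIdx) (qsKnitOfRecord N θ x.toKIdx) (parKnitY x.toKIdx) (GpPhysY x.toKIdx (parKnitY x.toKIdx))
          (𝔯 x).Δ2 ∧
      (lettersYOfRecordV11KH N θ Mstar 𝔯 x).H₁ =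
        H1QY x.toKIdx (qKnitOfRecord N θ x.toKIdx) (qsKnitOfRecord N θ x.toKIdx) (parKnitY x.toKIdx) (GpPhysY x.toKIdx (parKnitY x.toKIdx))
          (𝔯 x).Δ2 ∧
      (lettersYOfRecordV11KH N θ Mstar 𝔯 x).GG =
        GGQY x.toKIdx (qKnitOfRecord N θ x.toKIdx) (qsKnitOfRecord N θ x.toKIdx) (parKnitY x.toKIdx) (GpPhysY x.toKIdx (parKnitY x.toKIdx))
          (𝔯 x).Δ2 ∧
      (lettersYOfRecordV11KH N θ Mstar 𝔯 x).GA =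
        GAQY x.toKIdx (qKnitOfRecord N θ x.toKIdx) (qsKnitOfRecord N θ x.toKIdx) (parKnitY x.toKIdx) (GpY x.toKIdx (parKnitY x.toKIdx)) :=
  ⟨rfl, rfl, rfl, rfl, rfl, rfl, rfl, rfl⟩

end RecordKnit

end

end Literature.MathematicalPhysics.QuantumFieldTheory.Balaban1983to89.Node00
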